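import Mathlib
import Summits.QuantumFields.YangMills.Theorems.TransverseWardBLFluxSectors
import Summits.QuantumFields.YangMills.Theorems.ScalingWindowSplitSelfNormalisedSkewnessWitnessChart
import Literature.MathematicalPhysics.QuantumFieldTheory.WilsonFlow
import HarnessLib

/-!
# Translation invariance of the flux sectors: the transverse test functional has zero mean on each sector

Route-independent helper for the crux stmt-QuantumFields-23103 `Theses.TransverseWardBL.ConvexPhaseCoexactBound`
(route `TransverseWardBL`, LINE g9-C of the ideator seat ym-idea-4; abelian `U(1)` line onto the leaf
`Theorems.U1HelicityGapTorusD4` — nothing here bears on the Yang–Mills mass gap).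

Lattice translations `U ↦ U(· + a)` preserve the product Haar measure (`measurePreserving_siteTranslate`), the
cut `{∀ p, |ω_p| ≤ 1}`, the Wilson weight `exp(β Σ_q cos ω_q)` and — by flux constancy of admissible fields —
every flux sector `G_k` (`mem_sector_siteTranslate_iff`).  Hence the sector integral
`m(p) = ∫ 1_{G_k} sin ω_p · e^{βΣcos ω} dHaar` depends only on the orientation of `p`
(`sectorSinIntegral_shift`), and for a test form `u` with vanishing orientation sums
`∫ 1_{G_k} (Σ_p u_p sin ω_p) e^{βΣcos ω} dHaar = 0` (`integral_sector_testForm_eq_zero`): the transverse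
functional has ZERO MEAN on every sector (the planner's `stub_sectorMeanZero`).
-/

noncomputable section

open scoped BigOperators ENNReal
open MeasureTheory Finset
open Literature.MathematicalPhysics.QuantumLattice Literature.MathematicalPhysics.QuantumFieldTheory
open Summit.QuantumFields.YangMills.Theorems.SelfNormalisedSkewness.Negative

namespace Summit.QuantumFields.YangMills.Theorems.TransverseWardBL

variable {S : ℕ} [NeZero S]

/-! ### Measurability -/

/-- The magnetic flux is measurable in the configuration. [folklore] -/
theorem measurable_magneticFlux (x : Site 4 S) (μ ν : Fin 4) :
    Measurable fun U : GaugeConfig 4 S Circle => magneticFlux U x μ ν := by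
  unfold magneticFlux
  exact Finset.measurable_sum _ fun s _ => Finset.measurable_sum _ fun t _ => measurable_abelianFieldTensor _ _ _

/-- The sector `G_k = {cut} ∩ {fluxes = 2πk}` is measurable. [folklore] -/
theorem measurableSet_sector (k : {q : Fin 4 × Fin 4 // q.1 < q.2} → ℤ) :
    MeasurableSet {U : GaugeConfig 4 S Circle | (∀ p : Plaquette 4 S, |plaqAngle U p| ≤ 1) ∧
      ∀ o : {q : Fin 4 × Fin 4 // q.1 < q.2}, magneticFlux U 0 o.1.1 o.1.2 = 2 * Real.pi * k o} := by
  have e : {U : GaugeConfig 4 S Circle | (∀ p : Plaquette 4 S, |plaqAngle U p| ≤ 1) ∧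
      ∀ o : {q : Fin 4 × Fin 4 // q.1 < q.2}, magneticFlux U 0 o.1.1 o.1.2 = 2 * Real.pi * k o} =
      (⋂ p : Plaquette 4 S, {U | |plaqAngle U p| ≤ 1}) ∩
        ⋂ o : {q : Fin 4 × Fin 4 // q.1 < q.2}, {U | magneticFlux U 0 o.1.1 o.1.2 = 2 * Real.pi * k o} := by
    ext U; simp
  rw [e]
  refine (MeasurableSet.iInter fun p => ?_).inter (MeasurableSet.iInter fun o => ?_)
  · simp only [plaqAngle_apply]
    exact measurableSet_le (measurable_abelianFieldTensor p.1 p.2.1.1 p.2.1.2).abs measurable_const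
  · exact measurableSet_eq_fun (measurable_magneticFlux 0 o.1.1 o.1.2) measurable_const

omit [NeZero S] in
/-- `U ↦ ω_p(U)` is measurable. [folklore] -/
theorem measurable_plaqAngle_apply (p : Plaquette 4 S) :
    Measurable fun U : GaugeConfig 4 S Circle => plaqAngle U p := by
  simp only [plaqAngle_apply]; exact measurable_abelianFieldTensor _ _ _

/-! ### Lattice translations preserve Haar, the cut, the weight and the sectors -/

/-- **Lattice translations preserve the product Haar measure** (relabelling of the factors). [folklore] -/
theorem measurePreserving_siteTranslate (a : Site 4 S) :
    MeasurePreserving (fun U : GaugeConfig 4 S Circle => U.siteTranslate a)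
      (Measure.pi fun _ : Edge 4 S => haarProbability Circle)
      (Measure.pi fun _ : Edge 4 S => haarProbability Circle) := by
  set E : Edge 4 S ≃ Edge 4 S := Equiv.prodCongr (Equiv.addRight a) (Equiv.refl (Fin 4)) with hE
  have h := measurePreserving_piCongrLeft (fun _ : Edge 4 S => haarProbability Circle) E.symm
  have hcoe : ⇑(MeasurableEquiv.piCongrLeft (fun _ : Edge 4 S => Circle) E.symm) =
      fun U : GaugeConfig 4 S Circle => U.siteTranslate a := by
    funext U; funext e
    rw [MeasurableEquiv.coe_piCongrLeft, Equiv.piCongrLeft_apply_eq_cast, cast_eq]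
    simp [hE, GaugeConfig.siteTranslate]
    rfl
  rw [hcoe] at h
  exact h

omit [NeZero S] in
/-- `siteTranslate` is a measurable embedding (it is a measurable equivalence). [folklore] -/
theorem measurableEmbedding_siteTranslate (a : Site 4 S) :
    MeasurableEmbedding (fun U : GaugeConfig 4 S Circle => U.siteTranslate a) := by
  set E : Edge 4 S ≃ Edge 4 S := Equiv.prodCongr (Equiv.addRight a) (Equiv.refl (Fin 4)) with hE
  have hcoe : ⇑(MeasurableEquiv.piCongrLeft (fun _ : Edge 4 S => Circle) E.symm) =
      fun U : GaugeConfig 4 S Circle => U.siteTranslate a := by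
    funext U; funext e
    rw [MeasurableEquiv.coe_piCongrLeft, Equiv.piCongrLeft_apply_eq_cast, cast_eq]
    simp [hE, GaugeConfig.siteTranslate]
    rfl
  rw [← hcoe]
  exact (MeasurableEquiv.piCongrLeft (fun _ : Edge 4 S => Circle) E.symm).measurableEmbedding

omit [NeZero S] in
/-- Plaquette angles of a translated configuration. [folklore] -/
theorem plaqAngle_siteTranslate (a : Site 4 S) (U : GaugeConfig 4 S Circle) (p : Plaquette 4 S) :
    plaqAngle (U.siteTranslate a) p = plaqAngle U (p.1 + a, p.2) := by
  simp only [plaqAngle_apply, abelianFieldTensor, plaquetteHolonomy_siteTranslate]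

/-- Magnetic fluxes of a translated configuration. [folklore] -/
theorem magneticFlux_siteTranslate (a : Site 4 S) (U : GaugeConfig 4 S Circle) (x : Site 4 S) (μ ν : Fin 4) :
    magneticFlux (U.siteTranslate a) x μ ν = magneticFlux U (x + a) μ ν := by
  simp only [magneticFlux, abelianFieldTensor, plaquetteHolonomy_siteTranslate]
  refine Finset.sum_congr rfl fun s _ => Finset.sum_congr rfl fun t _ => ?_
  congr 2; abel

/-- Sums over all plaquettes are translation invariant. [folklore] -/
theorem sum_plaquette_siteTranslate (a : Site 4 S) (h : Plaquette 4 S → ℝ) :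
    ∑ q : Plaquette 4 S, h (q.1 + a, q.2) = ∑ q : Plaquette 4 S, h q :=
  Fintype.sum_equiv (Equiv.prodCongr (Equiv.addRight a) (Equiv.refl _)) _ _ fun _ => rfl

omit [NeZero S] in
/-- The cut is translation invariant. [folklore] -/
theorem cut_siteTranslate_iff (a : Site 4 S) (U : GaugeConfig 4 S Circle) :
    (∀ p : Plaquette 4 S, |plaqAngle (U.siteTranslate a) p| ≤ 1) ↔ ∀ p : Plaquette 4 S, |plaqAngle U p| ≤ 1 := by
  simp only [plaqAngle_siteTranslate]
  constructor
  · intro h p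
    have := h (p.1 - a, p.2)
    simpa using this
  · intro h p
    exact h _

/-- **Sectors are translation invariant** (flux constancy of admissible fields). [folklore] -/
theorem mem_sector_siteTranslate_iff (k : {q : Fin 4 × Fin 4 // q.1 < q.2} → ℤ) (a : Site 4 S)
    (U : GaugeConfig 4 S Circle) :
    ((∀ p : Plaquette 4 S, |plaqAngle (U.siteTranslate a) p| ≤ 1) ∧
        ∀ o : {q : Fin 4 × Fin 4 // q.1 < q.2}, magneticFlux (U.siteTranslate a) 0 o.1.1 o.1.2 = 2 * Real.pi * k o) ↔
      ((∀ p : Plaquette 4 S, |plaqAngle U p| ≤ 1) ∧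
        ∀ o : {q : Fin 4 × Fin 4 // q.1 < q.2}, magneticFlux U 0 o.1.1 o.1.2 = 2 * Real.pi * k o) := by
  rw [cut_siteTranslate_iff]
  constructor
  · rintro ⟨hU, hk⟩
    refine ⟨hU, fun o => ?_⟩
    have hadm := abs_abelianFieldTensor_lt_of_plaqAngle_le hU
    rw [← hk o, magneticFlux_siteTranslate, zero_add, magneticFlux_eq_of_admissible U hadm a 0]
  · rintro ⟨hU, hk⟩
    refine ⟨hU, fun o => ?_⟩
    have hadm := abs_abelianFieldTensor_lt_of_plaqAngle_le hU
    rw [magneticFlux_siteTranslate, zero_add, magneticFlux_eq_of_admissible U hadm a 0, hk o]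

/-! ### The one-plaquette sector integral depends only on the orientation -/

/-- **Translation invariance of the sector one-plaquette integral**:
`∫ 1_{G_k}(U) sin ω_{(x+a;o)}(U) e^{βΣcos ω(U)} dHaar = ∫ 1_{G_k}(U) sin ω_{(x;o)}(U) e^{βΣcos ω(U)} dHaar`. [folklore] -/
theorem sectorSinIntegral_shift (k : {q : Fin 4 × Fin 4 // q.1 < q.2} → ℤ) (β : ℝ) (a : Site 4 S)
    (p : Plaquette 4 S) :
    ∫ U, {U : GaugeConfig 4 S Circle | (∀ q : Plaquette 4 S, |plaqAngle U q| ≤ 1) ∧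
        ∀ o : {q : Fin 4 × Fin 4 // q.1 < q.2}, magneticFlux U 0 o.1.1 o.1.2 = 2 * Real.pi * k o}.indicator
        (fun U => Real.sin (plaqAngle U (p.1 + a, p.2)) *
          Real.exp (β * ∑ q : Plaquette 4 S, Real.cos (plaqAngle U q))) U
        ∂(Measure.pi fun _ : Edge 4 S => haarProbability Circle) =
      ∫ U, {U : GaugeConfig 4 S Circle | (∀ q : Plaquette 4 S, |plaqAngle U q| ≤ 1) ∧
        ∀ o : {q : Fin 4 × Fin 4 // q.1 < q.2}, magneticFlux U 0 o.1.1 o.1.2 = 2 * Real.pi * k o}.indicator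
        (fun U => Real.sin (plaqAngle U p) * Real.exp (β * ∑ q : Plaquette 4 S, Real.cos (plaqAngle U q))) U
        ∂(Measure.pi fun _ : Edge 4 S => haarProbability Circle) := by
  classical
  set Gk : Set (GaugeConfig 4 S Circle) := {U | (∀ q : Plaquette 4 S, |plaqAngle U q| ≤ 1) ∧
    ∀ o : {q : Fin 4 × Fin 4 // q.1 < q.2}, magneticFlux U 0 o.1.1 o.1.2 = 2 * Real.pi * k o} with hGk
  set ψ : GaugeConfig 4 S Circle → ℝ := Gk.indicator
    (fun U => Real.sin (plaqAngle U p) * Real.exp (β * ∑ q : Plaquette 4 S, Real.cos (plaqAngle U q))) with hψ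
  have hpt : ∀ U : GaugeConfig 4 S Circle, Gk.indicator
      (fun U => Real.sin (plaqAngle U (p.1 + a, p.2)) *
        Real.exp (β * ∑ q : Plaquette 4 S, Real.cos (plaqAngle U q))) U = ψ (U.siteTranslate a) := by
    intro U
    have hmem : U.siteTranslate a ∈ Gk ↔ U ∈ Gk := mem_sector_siteTranslate_iff k a U
    have hsum : ∑ q : Plaquette 4 S, Real.cos (plaqAngle (U.siteTranslate a) q) =
        ∑ q : Plaquette 4 S, Real.cos (plaqAngle U q) := by
      simp only [plaqAngle_siteTranslate]
      exact sum_plaquette_siteTranslate a (fun q => Real.cos (plaqAngle U q))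
    by_cases hU : U ∈ Gk
    · rw [Set.indicator_of_mem hU, hψ, Set.indicator_of_mem (hmem.2 hU), plaqAngle_siteTranslate, hsum]
    · rw [Set.indicator_of_notMem hU, hψ, Set.indicator_of_notMem (fun h => hU (hmem.1 h))]
  simp_rw [hpt]
  exact (measurePreserving_siteTranslate a).integral_comp (measurableEmbedding_siteTranslate a) ψ

/-- **Zero mean of the transverse functional on every sector**: for a test form `u` with vanishing
orientation sums, `∫ 1_{G_k}(U) (Σ_p u_p sin ω_p(U)) e^{βΣcos ω(U)} dHaar(U) = 0`. [folklore] -/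
theorem integral_sector_testForm_eq_zero (k : {q : Fin 4 × Fin 4 // q.1 < q.2} → ℤ) (β : ℝ)
    (u : Plaquette 4 S → ℝ)
    (hu0 : ∀ o : {q : Fin 4 × Fin 4 // q.1 < q.2}, (∑ q : Plaquette 4 S, (if q.2 = o then u q else 0)) = 0) :
    ∫ U, {U : GaugeConfig 4 S Circle | (∀ q : Plaquette 4 S, |plaqAngle U q| ≤ 1) ∧
        ∀ o : {q : Fin 4 × Fin 4 // q.1 < q.2}, magneticFlux U 0 o.1.1 o.1.2 = 2 * Real.pi * k o}.indicator
        (fun U => (∑ p : Plaquette 4 S, u p * Real.sin (plaqAngle U p)) *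
          Real.exp (β * ∑ q : Plaquette 4 S, Real.cos (plaqAngle U q))) U
        ∂(Measure.pi fun _ : Edge 4 S => haarProbability Circle) = 0 := by
  classical
  set μH : Measure (GaugeConfig 4 S Circle) := Measure.pi fun _ : Edge 4 S => haarProbability Circle with hμH
  set Gk : Set (GaugeConfig 4 S Circle) := {U | (∀ q : Plaquette 4 S, |plaqAngle U q| ≤ 1) ∧
    ∀ o : {q : Fin 4 × Fin 4 // q.1 < q.2}, magneticFlux U 0 o.1.1 o.1.2 = 2 * Real.pi * k o} with hGk
  have hGm : MeasurableSet Gk := measurableSet_sector k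
  set W : GaugeConfig 4 S Circle → ℝ := fun U => Real.exp (β * ∑ q : Plaquette 4 S, Real.cos (plaqAngle U q))
    with hW
  have hWm : Measurable W := Real.measurable_exp.comp ((Finset.measurable_sum _ fun q _ =>
    Real.measurable_cos.comp (measurable_plaqAngle_apply q)).const_mul β)
  have hWb : ∀ U, |W U| ≤ Real.exp (|β| * Fintype.card (Plaquette 4 S)) := fun U => by
    rw [hW, abs_of_pos (Real.exp_pos _)]
    refine Real.exp_le_exp.2 ?_
    calc β * ∑ q : Plaquette 4 S, Real.cos (plaqAngle U q) ≤ |β * ∑ q : Plaquette 4 S, Real.cos (plaqAngle U q)| :=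
          le_abs_self _
      _ = |β| * |∑ q : Plaquette 4 S, Real.cos (plaqAngle U q)| := abs_mul _ _
      _ ≤ |β| * Fintype.card (Plaquette 4 S) := by
          refine mul_le_mul_of_nonneg_left ?_ (abs_nonneg β)
          calc |∑ q : Plaquette 4 S, Real.cos (plaqAngle U q)| ≤ ∑ q : Plaquette 4 S, |Real.cos (plaqAngle U q)| :=
                Finset.abs_sum_le_sum_abs _ _
            _ ≤ ∑ _q : Plaquette 4 S, (1 : ℝ) := Finset.sum_le_sum fun q _ => Real.abs_cos_le_one _
            _ = Fintype.card (Plaquette 4 S) := by simp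
  -- the one-plaquette sector integrals
  set m : Plaquette 4 S → ℝ := fun p => ∫ U, Gk.indicator (fun U => Real.sin (plaqAngle U p) * W U) U ∂μH
    with hm
  have hmo : ∀ p : Plaquette 4 S, m p = m ((0 : Site 4 S), p.2) := fun p => by
    have h := sectorSinIntegral_shift (S := S) k β p.1 ((0 : Site 4 S), p.2)
    simp only [zero_add, Prod.mk.eta] at h
    simp only [hm, hμH, hGk, hW]
    exact h
  -- integrability of the summands
  have hint : ∀ p : Plaquette 4 S, Integrable (fun U => u p * Gk.indicator
      (fun U => Real.sin (plaqAngle U p) * W U) U) μH := by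
    intro p
    refine (Integrable.of_bound ?_ (Real.exp (|β| * Fintype.card (Plaquette 4 S))) (ae_of_all _ fun U => ?_)).const_mul (u p)
    · exact (((Real.measurable_sin.comp (measurable_plaqAngle_apply p)).mul hWm).indicator hGm).aestronglyMeasurable
    · rw [Real.norm_eq_abs]
      by_cases hU : U ∈ Gk
      · rw [Set.indicator_of_mem hU, abs_mul]
        calc |Real.sin (plaqAngle U p)| * |W U| ≤ 1 * |W U| :=
              mul_le_mul_of_nonneg_right (Real.abs_sin_le_one _) (abs_nonneg _)
          _ ≤ Real.exp (|β| * Fintype.card (Plaquette 4 S)) := by rw [one_mul]; exact hWb U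
      · rw [Set.indicator_of_notMem hU, abs_zero]; positivity
  -- rewrite the integrand as a sum
  have hsum : ∀ U : GaugeConfig 4 S Circle, Gk.indicator
      (fun U => (∑ p : Plaquette 4 S, u p * Real.sin (plaqAngle U p)) * W U) U =
      ∑ p : Plaquette 4 S, u p * Gk.indicator (fun U => Real.sin (plaqAngle U p) * W U) U := by
    intro U
    by_cases hU : U ∈ Gk
    · simp only [Set.indicator_of_mem hU, Finset.sum_mul, mul_assoc]
    · simp only [Set.indicator_of_notMem hU, mul_zero, Finset.sum_const_zero]
  show ∫ U, Gk.indicator (fun U => (∑ p : Plaquette 4 S, u p * Real.sin (plaqAngle U p)) * W U) U ∂μH = 0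
  simp_rw [hsum]
  rw [integral_finsetSum _ fun p _ => hint p]
  have hcm : ∑ p : Plaquette 4 S, ∫ U, u p * Gk.indicator (fun U => Real.sin (plaqAngle U p) * W U) U ∂μH =
      ∑ p : Plaquette 4 S, u p * m p :=
    Finset.sum_congr rfl fun p _ => by rw [integral_const_mul]
  rw [hcm]
  -- regroup by orientation
  have hreg : ∑ p : Plaquette 4 S, u p * m p =
      ∑ o : {q : Fin 4 × Fin 4 // q.1 < q.2}, m ((0 : Site 4 S), o) *
        ∑ q : Plaquette 4 S, (if q.2 = o then u q else 0) := by
    have h1 : ∀ p : Plaquette 4 S, u p * m p =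
        ∑ o : {q : Fin 4 × Fin 4 // q.1 < q.2}, (if p.2 = o then m ((0 : Site 4 S), o) * u p else 0) := by
      intro p
      rw [Finset.sum_ite_eq, if_pos (Finset.mem_univ _), hmo p, mul_comm]
    simp_rw [h1]
    rw [Finset.sum_comm]
    refine Finset.sum_congr rfl fun o _ => ?_
    rw [Finset.mul_sum]
    refine Finset.sum_congr rfl fun q _ => ?_
    split_ifs <;> simp
  rw [hreg]
  simp [hu0]

end Summit.QuantumFields.YangMills.Theorems.TransverseWardBL

end
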